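import Summits.MatrixMultiplication.MatrixMultiplication.Theorems.ObstructionCalculusSchurWeylConverse
import Summits.MatrixMultiplication.MatrixMultiplication.Theorems.ObstructionCalculusLocality

set_option linter.dupNamespace false
set_option autoImplicit false

/-!
# Occurrence calculus — live types and low-degree universality of `⟨m⟩` through the Schur–Weyl bridge (decomp-mm · lens 3 · gen 29)

Route-free corollaries of the bridge (`ObstructionCalculusSchurWeyl` ⟸, `…Converse` ⟹) in Bürgisser–Ikenmeyer's semigroup currency,
for a triple of partitions `λ ⊢ d` and its reversed type `Λ` (`Λ s (rev i) = (λˢ)_i`):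
* `hwvSpace_ne_bot_iff_exists_isotypicSum_ne_zero` — **a type is LIVE iff its triple occurs in SOME tensor of format `m`**:
  `hwvSpace Λ d ≠ ⊥ ⟺ ∃ t ∈ ℂ^m⊗ℂ^m⊗ℂ^m, isoSum_λ(t^{⊗d}) ≠ 0` (⟹: a non-zero complex polynomial has a non-root, which is a tensor
  not killed by the type; ⟸: the bridge).
* `isotypicSum_kroneckerPow_unitTensor_ne_zero_of_degree_le` — **`⟨m⟩` is occurrence-maximal in degrees `d ≤ m`**: `S(t)_{≤ m} ⊆ S(⟨m⟩)` for
  EVERY `t` of format `m` (the calculus' degree engine `hwvSpace_eq_bot_of_degree_le` — `σ_m` has no equations of degree `≤ m` — pushed through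
  the bridge).  For the crux `P_O` (stmt 29040) this is the semigroup form of the rung «obligations have degree `d > m`».
No proposition is defined; no `def`; sorry-free; standard axioms.  Nothing here proves `ω = 2` or closes an item.
[cite: BurgisserIkenmeyer2011, §3.1, §4 (Prop. 4.2: the unit tensor is stable), §5] [cite: LandsbergGCT2017, Prop. 8.3.4.1]
-/

noncomputable section

open scoped BigOperators

namespace Summit.MatrixMultiplication.MatrixMultiplication.Theorems.ObstructionCalculus

open Literature.Computability.AlgebraicComplexity (actTensor actTensor_one kroneckerPow isotypicSum₁ isotypicSum₂ isotypicSum₃ unitTensor)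

variable {m d : ℕ}

/-- A non-zero polynomial on `ℂ^{m×m×m}` is non-zero at some tensor (infinite field). [folklore] -/
theorem exists_evalT_ne_zero {f : MvPolynomial (Idx m) ℂ} (hf : f ≠ 0) : ∃ t : Tensor ℂ m, evalT t f ≠ 0 := by
  by_contra hall
  push Not at hall
  apply hf
  refine MvPolynomial.funext fun x => ?_
  have h := hall (fun a b c => x (a, b, c))
  rw [map_zero]
  exact h

/-- A polynomial not vanishing at `t` is not in the orbit ideal of `t` (take `A = B = C = 1`). [bookkeeping] -/
theorem not_mem_orbitVanishing_of_evalT_ne_zero {t : Tensor ℂ m} {f : MvPolynomial (Idx m) ℂ} (h : evalT t f ≠ 0) :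
    f ∉ orbitVanishing t := by
  intro hf
  have h1 := (mem_orbitVanishing.1 hf) 1 1 1 (by simp) (by simp) (by simp)
  rw [actTensor_one] at h1
  exact h h1

/-- **A type is live iff its triple occurs in some tensor of the format**: for `λ ⊢ d` and its reversed type `Λ`,
`hwvSpace Λ d ≠ ⊥ ⟺ ∃ t ∈ ℂ^m⊗ℂ^m⊗ℂ^m, isoSum_λ(t^{⊗d}) ≠ 0`. [cite: BurgisserIkenmeyer2011, §3.1] -/
theorem hwvSpace_ne_bot_iff_exists_isotypicSum_ne_zero (lam : Fin 3 → Nat.Partition d) (Λ : Fin 3 → Fin m → ℕ)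
    (hΛ : ∀ (s : Fin 3) (i : Fin m), Λ s (Fin.rev i) = (lam s).sortedParts.getD i 0) :
    hwvSpace Λ d ≠ ⊥ ↔
      ∃ t : Tensor ℂ m, isotypicSum₁ (lam 0) (isotypicSum₂ (lam 1) (isotypicSum₃ (lam 2) (kroneckerPow t d))) ≠ 0 := by
  constructor
  · intro h
    obtain ⟨f, hf, hf0⟩ := (Submodule.ne_bot_iff _).1 h
    obtain ⟨t, ht⟩ := exists_evalT_ne_zero hf0
    refine ⟨t, isotypicSum_ne_zero_of_not_hwvSpace_le_orbitVanishing t lam Λ hΛ fun hle => ?_⟩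
    exact not_mem_orbitVanishing_of_evalT_ne_zero ht (hle hf)
  · rintro ⟨t, ht⟩ hbot
    exact not_hwvSpace_le_orbitVanishing_of_isotypicSum_ne_zero t lam Λ hΛ ht (hbot ▸ bot_le)

/-- **`⟨m⟩` is occurrence-maximal in degrees `d ≤ m`**: for every tensor `t` of format `m` and every triple `λ ⊢ d` with `d ≤ m`,
`isoSum_λ(t^{⊗d}) ≠ 0 ⟹ isoSum_λ(⟨m⟩^{⊗d}) ≠ 0`, i.e. `S(t)_{≤m} ⊆ S(⟨m⟩)`.  (The reversed type of `λ` is live by the bridge, and a live type of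
degree `≤ m` is not killed by `σ_m`, which has no equations of degree `≤ m`.) [cite: LandsbergGCT2017, Prop. 8.3.4.1] [cite: BurgisserIkenmeyer2011, §5] -/
theorem isotypicSum_kroneckerPow_unitTensor_ne_zero_of_degree_le (hd : d ≤ m) (t : Tensor ℂ m) (lam : Fin 3 → Nat.Partition d)
    (hocc : isotypicSum₁ (lam 0) (isotypicSum₂ (lam 1) (isotypicSum₃ (lam 2) (kroneckerPow t d))) ≠ 0) :
    isotypicSum₁ (lam 0) (isotypicSum₂ (lam 1) (isotypicSum₃ (lam 2) (kroneckerPow (unitTensor ℂ m) d))) ≠ 0 := by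
  set Λ : Fin 3 → Fin m → ℕ := fun s i => (lam s).sortedParts.getD (Fin.rev i) 0 with hΛdef
  have hΛ : ∀ (s : Fin 3) (i : Fin m), Λ s (Fin.rev i) = (lam s).sortedParts.getD i 0 := by
    intro s i
    show (lam s).sortedParts.getD (Fin.rev (Fin.rev i)) 0 = _
    rw [Fin.rev_rev]
  have hlive : hwvSpace Λ d ≠ ⊥ := (hwvSpace_ne_bot_iff_exists_isotypicSum_ne_zero lam Λ hΛ).2 ⟨t, hocc⟩
  refine isotypicSum_ne_zero_of_not_hwvSpace_le_orbitVanishing (unitTensor ℂ m) lam Λ hΛ fun hle => ?_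
  exact hlive (hwvSpace_eq_bot_of_degree_le hd hle)

/-- The same with the type given: a LIVE type of degree `d ≤ m` is an occurrence of `⟨m⟩` (semigroup reading of the degree engine).
[cite: LandsbergGCT2017, Prop. 8.3.4.1] -/
theorem isotypicSum_kroneckerPow_unitTensor_ne_zero_of_hwvSpace_ne_bot (hd : d ≤ m) (lam : Fin 3 → Nat.Partition d)
    (Λ : Fin 3 → Fin m → ℕ) (hΛ : ∀ (s : Fin 3) (i : Fin m), Λ s (Fin.rev i) = (lam s).sortedParts.getD i 0)
    (hlive : hwvSpace Λ d ≠ ⊥) :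
    isotypicSum₁ (lam 0) (isotypicSum₂ (lam 1) (isotypicSum₃ (lam 2) (kroneckerPow (unitTensor ℂ m) d))) ≠ 0 :=
  isotypicSum_ne_zero_of_not_hwvSpace_le_orbitVanishing (unitTensor ℂ m) lam Λ hΛ fun hle =>
    hlive (hwvSpace_eq_bot_of_degree_le hd hle)

end Summit.MatrixMultiplication.MatrixMultiplication.Theorems.ObstructionCalculus

end
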